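import Summits.HodgeConjecture.HodgeConjecture.Theorems.Ring2Hypotheses
import Summits.HodgeConjecture.HodgeConjecture.Theorems.Ring2ClassTargets
import Literature.AlgebraicGeometry.HodgeTheory.AlgebraicClassesCupSubmaximalDegree
import Literature.AlgebraicGeometry.HodgeTheory.LefschetzOneOneHolds
import Literature.AlgebraicGeometry.HodgeTheory.IsoTransport
import HarnessLib

/-!
# Ring 2 — binder seat b02 (Hodge ladder stage 3): the RUNGS of row b02 `AbelianSchemeVHC` on the axis
# (relative dimension `n`, codimension `p`) — its unconditional floor and its first open cells

HONEST FRAMING: research route conditional on HC_CM; not a corollary; Q11.4-sentence-2 already refuted in dim ≥ 3.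

Cell `pub-hodge-ring2`, Hodge ladder stage 3, binder seat `ring2-b02` (row b02 of `BINDER-OWNERS.md`: the named
hypothesis `Ring2.Hypotheses.AbelianSchemeVHC`, `Theorems/Ring2Hypotheses.lean` — Grothendieck's variational Hodge
conjecture, global-class form, along smooth projective families `f : 𝒳 ⟶ S` of relative dimension `n` over a smooth
irreducible `S` ALL of whose complex fibres are abelian varieties: a class `W ∈ H²ᵖ(𝒳(ℂ);ℂ)` that is fibrewise
rational `(p,p)` and algebraic on one fibre is algebraic on every fibre; OPEN). Nothing in this file proves a new
case of the Hodge conjecture and `HC_CM` (`Theses.RankFourFaces.CMAbelianHodge`) does not occur in it. Rows b05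
(`Ring2HypothesesDescentMotivatedRungs.lean`) and b06 (`Ring2HypothesesDescentAbsoluteRungs.lean`) have their graded
rungs in the tree; row b02 had none. This file grades row b02 by the pair (relative dimension `n`, codimension `p`)
and records in the kernel where its open content begins — fact-free in §§1, 2 and 4; §3 displays the atlas' two
printed inputs for dimension `≤ 5` as hypotheses.

## What is proved (sorry-free; the two classical Lefschetz theorems enter through their DISCHARGED tree theorems
## `lefschetzOneOne_rational_holds`, `nonempty_hardLefschetzNFold_holds`; the only named facts are §3's hypotheses `hW`, `hMZ`)

* §1 THE FIBREWISE ENGINE (fact-free). The conclusion of row b02 at a complex point `s` follows from the Hodge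
  conjecture for the ONE abelian variety `A' ≅ 𝒳_s` presenting that fibre, transported along the presentation
  (`IsoTransport`); hence the graded on-path lemma **`HCAtDim n ⟹ row b02 in relative dimension n`**, i.e.
  `HCUpToDim g ⟹ AbelianSchemeVHCUpTo[g]` (`abelianSchemeVHC_upTo_of_hcUpToDim`), the dimension-graded form of the
  dictionary's `abelianSchemeVHC_of_hc_av`; and row b02 is the conjunction of its dimension slices.
* §2 THE UNCONDITIONAL FLOOR. (a) In the Lefschetz range of codimensions `p ≤ 1 ∨ n ≤ p + 1` the conclusion of row
  b02 holds on EVERY smooth projective family, abelian or not, with no anchor and no hypothesis on the base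
  (`abelianSchemeVHC_conclusion_of_lefschetzRange`: Lefschetz `(1,1)`, hard Lefschetz `Lⁿ⁻² : H² ⥲ H²ⁿ⁻²` and the
  point class, fibre by fibre — the tree's `mem_algebraicClasses_of_lefschetzRange_holds`). (b) Hence **row b02 HOLDS
  for families of abelian varieties of relative dimension `n ≤ 3`** (`abelianSchemeVHC_upTo_three`), unconditionally.
  (c) **Row b02 IS its restriction to relative dimension `n ≥ 4` and the middle range `2 ≤ p ≤ n - 2`**
  (`abelianSchemeVHC_iff_middleFrom_four`), unconditionally: the first cell of row b02 with content is
  `(n, p) = (4, 2)` — codimension-2 classes along families of abelian FOURFOLDS.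
* §3 UP THE DIMENSION AXIS (the cell's typed class targets `Ring2.ClassTargets.HCUpToDim g`, no `HC_CM`).
  `HCUpToDim g ⟹ (row b02 ⟺ its restriction to n ≥ g + 1, 2 ≤ p ≤ n - 2)` (`abelianSchemeVHC_iff_middleFrom_of_hcUpToDim`);
  so row b02 holds up to relative dimension `5` granted the support item `Theses.SevenfoldWeilCensus.HodgeAbelianDimLeFive`
  (stmt-HodgeConjecture-18723; = Markman 2025 Cor. 1.3, CLAIM) or granted its two printed inputs (Weil classes on
  Weil-type abelian fourfolds, `Markman2025_weilClasses_algebraic_abelianFourfold`, CLAIM in general; Moonen–Zarhin's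
  refereed reduction `MoonenZarhin1999_hodgeClasses_abelian_dim_le_five_of_weilClassesFourfolds`) — both displayed as
  HYPOTHESES —, and then row b02 IS its restriction to `n ≥ 6`, `2 ≤ p ≤ n - 2`; and up to relative dimension `7`
  granted the four open items of route `SevenfoldWeilCensus` (by name), after which row b02 IS its restriction to
  `n ≥ 8`, `2 ≤ p ≤ n - 2`.
* §4 THE DEEP MIDDLE OF `HC_AV` SUFFICES: row b02 follows from the Hodge conjecture for rational `(p,p)`-classes with
  `2 ≤ p`, `2p ≤ dim A` on complex abelian varieties `A` (`abelianSchemeVHC_of_hodgeAbelianVarieties_deepMiddle`;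
  Kerr–Pearlstein's halving, unconditional in the tree). HONEST LIMIT, not claimed: row b02 is NOT shown equivalent to
  its own lower half `2 ≤ p ≤ n/2` — descending a class `W|_{𝒳_s} = L^{2p-n} c'_s` above the middle to a VARIATIONAL
  statement below it needs a global class restricting to the `c'_s` (the theorem of the fixed part) and the
  algebraicity of `c'_{s₀}` at the anchor (Lieberman's `B(A)`); that halving is the AbelianAll axis' part XXI-a
  (`Ring2AbelianAllAndrePrimitiveLift.lean`, compact pencils of abelian varieties), not repeated here.

So, in the kernel and fact-free: the binder `AbelianSchemeVHC` carries no content below relative dimension `4` or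
outside `2 ≤ p ≤ n - 2`; modulo Markman's fourfold claim and Moonen–Zarhin its content starts at relative dimension
`6`. The graded statements are FILE-LOCAL NOTATIONS (`AbelianSchemeVHCUpTo[g]`, `AbelianSchemeVHCMiddleFrom[g]`),
not definitions: no node is introduced.

References: [Grothendieck1966] footnote 13; [CharlesSchnell2014Notes] Conj. 11.3.1, Cor. 11.3.6 and the remark
before Prop. 11.3.5; [VoisinHodgeI2002] Thm. 6.25, Rem. 6.27, Thm. 11.30; [VoisinHodgeII2003] §10.2.3 proof of
Prop. 10.26; [KerrPearlstein2011] §3.1; [MoonenZarhin1999LowDim] Thms. 0.1–0.2; [Markman2025SurveySecant] Thm. 1.2,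
Cor. 1.3 (unrefereed); [Deligne1982HodgeCycles] Milne's 2003 re-edition endnote 19.
-/

-- every declaration of this problem lives in `Summit.HodgeConjecture.HodgeConjecture.…` (summit = sub-problem);
-- namespace `…Ring2.Binders` = the binder seats of the cell's Hodge-ladder stage 3 (`BINDER-OWNERS.md`)
set_option linter.dupNamespace false

noncomputable section

open CategoryTheory AlgebraicGeometry
open Literature.AlgebraicGeometry Literature.AlgebraicGeometry.Motives
open Literature.AlgebraicGeometry.HodgeTheory

namespace Summit.HodgeConjecture.HodgeConjecture.Ring2.Binders

open Summit.HodgeConjecture.HodgeConjecture.Ring2.Hypotheses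
open Summit.HodgeConjecture.HodgeConjecture.Ring2.ClassTargets

/-! ## §0 The graded statements (file-local notations; nothing is defined or asserted)

`AbelianSchemeVHCUpTo[g]` is row b02 `AbelianSchemeVHC` with the extra hypothesis `n ≤ g` on the relative dimension;
`AbelianSchemeVHCMiddleFrom[g]` is row b02 with the extra hypotheses `g ≤ n` and `2 ≤ p`, `p + 2 ≤ n` (the middle
range of codimensions). Both are symbol for symbol the body of `Ring2.Hypotheses.AbelianSchemeVHC` with binders
inserted (so that `∀ g, AbelianSchemeVHCUpTo[g]` is the row: `abelianSchemeVHC_iff_forall_upTo`). -/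

/-- Row b02 restricted to relative dimension `n ≤ g` (file-local notation; a HYPOTHESIS or a CONCLUSION below, never
asserted as such beyond what is proved). -/
local notation3 (prettyPrint := false) "AbelianSchemeVHCUpTo[" g "]" =>
  ∀ ⦃n : ℕ⦄ ⦃𝒳 S : SchemeOver ℂ⦄ (f : 𝒳 ⟶ S), IsSmoothProjectiveFamily f n → n ≤ g → IrreducibleSpace S.left →
    AlgebraicGeometry.Smooth S.hom →
    (∀ s : ComplexPoints S, ∃ A' : AbelianVariety ℂ, A'.dim = n ∧ Nonempty (A'.X ≅ fiberOver f s)) →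
    ∀ (p : ℕ) (W : complexBetti 𝒳 (2 * p)),
      (∀ s : ComplexPoints S, IsRationalClass (complexBetti.map (fiberι f s) (2 * p) W) ∧
        IsOfHodgeType n (fiberOver f s) (2 * p) p p (complexBetti.map (fiberι f s) (2 * p) W)) →
      (∃ s₀ : ComplexPoints S,
        complexBetti.map (fiberι f s₀) (2 * p) W ∈ algebraicClasses (fiberOver f s₀) p) →
      ∀ s : ComplexPoints S, complexBetti.map (fiberι f s) (2 * p) W ∈ algebraicClasses (fiberOver f s) p

/-- Row b02 restricted to relative dimension `n ≥ g` AND the middle range of codimensions `2 ≤ p ≤ n - 2`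
(file-local notation). -/
local notation3 (prettyPrint := false) "AbelianSchemeVHCMiddleFrom[" g "]" =>
  ∀ ⦃n : ℕ⦄ ⦃𝒳 S : SchemeOver ℂ⦄ (f : 𝒳 ⟶ S), IsSmoothProjectiveFamily f n → g ≤ n → IrreducibleSpace S.left →
    AlgebraicGeometry.Smooth S.hom →
    (∀ s : ComplexPoints S, ∃ A' : AbelianVariety ℂ, A'.dim = n ∧ Nonempty (A'.X ≅ fiberOver f s)) →
    ∀ (p : ℕ), 2 ≤ p → p + 2 ≤ n → ∀ (W : complexBetti 𝒳 (2 * p)),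
      (∀ s : ComplexPoints S, IsRationalClass (complexBetti.map (fiberι f s) (2 * p) W) ∧
        IsOfHodgeType n (fiberOver f s) (2 * p) p p (complexBetti.map (fiberι f s) (2 * p) W)) →
      (∃ s₀ : ComplexPoints S,
        complexBetti.map (fiberι f s₀) (2 * p) W ∈ algebraicClasses (fiberOver f s₀) p) →
      ∀ s : ComplexPoints S, complexBetti.map (fiberι f s) (2 * p) W ∈ algebraicClasses (fiberOver f s) p

/-! ## §1 The fibrewise engine: one abelian presentation of one fibre (fact-free) -/

/-- **The conclusion of row b02 at `s` from the Hodge conjecture for ONE abelian variety presenting the fibre.** If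
`e : A'.X ≅ 𝒳_s` with `dim A' = n` and `HodgeConjectureFor A'.dim A'.X`, then every class `W ∈ H²ᵖ(𝒳(ℂ);ℂ)` whose
restriction `W|_{𝒳_s}` is rational of type `(p,p)` (for the relative dimension `n`) has `W|_{𝒳_s}` algebraic:
rationality, Hodge type and algebraicity all move along `e` (`forall_hodgeClass_mem_algebraicClasses_iff_of_iso`).
No anchor, no base hypothesis, no other fibre is used. [cite: CharlesSchnell2014Notes, Cor. 11.3.6]
[cite: SerreGAGA1956, §2] -/
theorem abelianSchemeVHC_conclusion_of_hodgeConjectureFor_of_iso {n : ℕ} {𝒳 S : SchemeOver ℂ} (f : 𝒳 ⟶ S)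
    {p : ℕ} (W : complexBetti 𝒳 (2 * p)) (s : ComplexPoints S) {A' : AbelianVariety ℂ}
    (e : A'.X ≅ fiberOver f s) (hdim : A'.dim = n) (hHC : HodgeConjectureFor A'.dim A'.X)
    (hW : IsRationalClass (complexBetti.map (fiberι f s) (2 * p) W) ∧
      IsOfHodgeType n (fiberOver f s) (2 * p) p p (complexBetti.map (fiberι f s) (2 * p) W)) :
    complexBetti.map (fiberι f s) (2 * p) W ∈ algebraicClasses (fiberOver f s) p := by
  subst hdim
  exact (forall_hodgeClass_mem_algebraicClasses_iff_of_iso e p).1 (hHC.2 p) _ hW.1 hW.2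

/-- **The conclusion of row b02 at `s` from the dimension row `HCAtDim n`** (`Ring2.ClassTargets`: the Hodge
conjecture for complex abelian varieties of dimension exactly `n`), given an abelian presentation of the fibre
`𝒳_s`. [cite: CharlesSchnell2014Notes, Cor. 11.3.6] -/
theorem abelianSchemeVHC_conclusion_of_hcAtDim {n : ℕ} {𝒳 S : SchemeOver ℂ} (f : 𝒳 ⟶ S) {p : ℕ}
    (W : complexBetti 𝒳 (2 * p)) (s : ComplexPoints S) (hHC : HCAtDim n)
    (habel : ∃ A' : AbelianVariety ℂ, A'.dim = n ∧ Nonempty (A'.X ≅ fiberOver f s))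
    (hW : IsRationalClass (complexBetti.map (fiberι f s) (2 * p) W) ∧
      IsOfHodgeType n (fiberOver f s) (2 * p) p p (complexBetti.map (fiberι f s) (2 * p) W)) :
    complexBetti.map (fiberι f s) (2 * p) W ∈ algebraicClasses (fiberOver f s) p := by
  obtain ⟨A', hdim, ⟨e⟩⟩ := habel
  exact abelianSchemeVHC_conclusion_of_hodgeConjectureFor_of_iso f W s e hdim (hHC A' hdim) hW

/-- **GRADED ON-PATH LEMMA: `HCUpToDim g ⟹` row b02 up to relative dimension `g`** — the dimension-graded form of
the dictionary's `abelianSchemeVHC_of_hc_av` (the anchor and the base are idle: on an abelian-fibred family the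
variational Hodge conjecture is a CONSEQUENCE of the Hodge conjecture on the fibres). [cite: CharlesSchnell2014Notes, Cor. 11.3.6]
[cite: Deligne1982HodgeCycles, Milne 2003 re-edition endnote 19] -/
theorem abelianSchemeVHC_upTo_of_hcUpToDim {g : ℕ} (h : HCUpToDim g) : AbelianSchemeVHCUpTo[g] := by
  intro n 𝒳 S f _ hn _ _ habel p W hW _ s
  exact abelianSchemeVHC_conclusion_of_hcAtDim f W s (hcAtDim_of_hcUpToDim (hcUpToDim_mono hn h)) (habel s)
    (hW s)

/-- Row b02 gives each of its dimension slices (forget `n ≤ g`). [folklore] -/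
theorem abelianSchemeVHCUpTo_of_abelianSchemeVHC (g : ℕ) (h : AbelianSchemeVHC) : AbelianSchemeVHCUpTo[g] := by
  intro n 𝒳 S f hf _ hirr hsm habel p W hW h₀ s
  exact h f hf hirr hsm habel p W hW h₀ s

/-- **Row b02 is the conjunction of its dimension slices** (bookkeeping; compare
`Ring2.ClassTargets.hodgeAbelianVarieties_iff_forall_hcAtDim` for `HC_AV`). [folklore] -/
theorem abelianSchemeVHC_iff_forall_upTo : AbelianSchemeVHC ↔ ∀ g : ℕ, AbelianSchemeVHCUpTo[g] := by
  refine ⟨fun h g => abelianSchemeVHCUpTo_of_abelianSchemeVHC g h, fun h => ?_⟩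
  intro n 𝒳 S f hf hirr hsm habel p W hW h₀ s
  exact h n f hf le_rfl hirr hsm habel p W hW h₀ s

/-! ## §2 The unconditional floor of row b02 -/

/-- **The Lefschetz range, unconditionally, on EVERY smooth projective family**: for `f : 𝒳 ⟶ S` smooth projective
of relative dimension `n`, a codimension `p` with `p ≤ 1` or `n ≤ p + 1`, and any class `W ∈ H²ᵖ(𝒳(ℂ);ℂ)` whose
restriction to the fibre `𝒳_s` is rational of type `(p,p)`, that restriction is algebraic — `p = 0`: `N⁰H⁰ = H⁰`;
`p = 1`: Lefschetz `(1,1)` (Voisin I Thm. 11.30, tree theorem `lefschetzOneOne_rational_holds`); `2 ≤ p = n - 1`: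
hard Lefschetz `Lⁿ⁻² : H² ⥲ H²ⁿ⁻²` over `ℚ` of bidegree `(n-2, n-2)` and `[H]ⁿ⁻² ∪ [D] = [Hⁿ⁻²·D]` (Voisin I Thm. 6.25,
tree theorem `nonempty_hardLefschetzNFold_holds`); `p = n`: the point class; `p > n`: no non-zero `(p,p)`-classes
(all packaged by the tree's `mem_algebraicClasses_of_lefschetzRange_holds` on the smooth projective `n`-fold `𝒳_s`).
No anchor, no abelian fibre, no hypothesis on `S`. (The AnchorTransport route's
`Theorems.variationalHodge_conclusion_of_lefschetzRange` is the same sentence with the two Lefschetz theorems as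
named-fact binders; here they are discharged.) [cite: VoisinHodgeI2002, Thm. 6.25, Rem. 6.27 and Thm. 11.30]
[cite: KerrPearlstein2011, §3.1] -/
theorem abelianSchemeVHC_conclusion_of_lefschetzRange {n : ℕ} {𝒳 S : SchemeOver ℂ} (f : 𝒳 ⟶ S)
    (hf : IsSmoothProjectiveFamily f n) {p : ℕ} (hp : p ≤ 1 ∨ n ≤ p + 1) (W : complexBetti 𝒳 (2 * p))
    (s : ComplexPoints S)
    (hW : IsRationalClass (complexBetti.map (fiberι f s) (2 * p) W) ∧
      IsOfHodgeType n (fiberOver f s) (2 * p) p p (complexBetti.map (fiberι f s) (2 * p) W)) :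
    complexBetti.map (fiberι f s) (2 * p) W ∈ algebraicClasses (fiberOver f s) p :=
  mem_algebraicClasses_of_lefschetzRange_holds (hf.isSmoothProjective s) hp _ hW.1 hW.2

/-- **Row b02 HOLDS for families of relative dimension `n ≤ 3`, unconditionally**: for `n ≤ 3` every codimension
lies in the Lefschetz range `p ≤ 1 ∨ n ≤ p + 1` (Voisin II, proof of Prop. 10.26: "as `X'` is of dimension `≤ 3`,
the rational Hodge conjecture holds … in every degree"). The anchor, the abelian fibres, irreducibility and
smoothness of the base are all idle. (Equivalently: `abelianSchemeVHC_upTo_of_hcUpToDim hcUpToDim_three`.)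
[cite: VoisinHodgeII2003, §10.2.3 proof of Prop. 10.26] [cite: VoisinHodgeI2002, Thm. 6.25 and Thm. 11.30] -/
theorem abelianSchemeVHC_upTo_three : AbelianSchemeVHCUpTo[3] := by
  intro n 𝒳 S f hf hn _ _ _ p W hW _ s
  exact abelianSchemeVHC_conclusion_of_lefschetzRange f hf (by omega) W s (hW s)

/-- Restriction: row b02 gives its middle-range form from any relative dimension `g` on (forget the extra binders).
[folklore] -/
theorem abelianSchemeVHCMiddleFrom_of_abelianSchemeVHC (g : ℕ) (h : AbelianSchemeVHC) :
    AbelianSchemeVHCMiddleFrom[g] := by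
  intro n 𝒳 S f hf _ hirr hsm habel p _ _ W hW h₀ s
  exact h f hf hirr hsm habel p W hW h₀ s

/-- **GLUING: a dimension slice `n ≤ g` and the middle range from `n ≥ g + 1` on give row b02**, unconditionally —
off the middle range the Lefschetz-range floor `abelianSchemeVHC_conclusion_of_lefschetzRange` concludes.
[cite: VoisinHodgeI2002, Thm. 6.25 and Thm. 11.30] -/
theorem abelianSchemeVHC_of_upTo_of_middleFrom {g : ℕ} (h₁ : AbelianSchemeVHCUpTo[g])
    (h₂ : AbelianSchemeVHCMiddleFrom[g + 1]) : AbelianSchemeVHC := by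
  intro n 𝒳 S f hf hirr hsm habel p W hW h₀ s
  rcases Nat.lt_or_ge g n with hgn | hng
  · by_cases hp : p ≤ 1 ∨ n ≤ p + 1
    · exact abelianSchemeVHC_conclusion_of_lefschetzRange f hf hp W s (hW s)
    · exact h₂ f hf (by omega) hirr hsm habel p (by omega) (by omega) W hW h₀ s
  · exact h₁ f hf hng hirr hsm habel p W hW h₀ s

/-- **Row b02 from its restriction to relative dimension `n ≥ 4` and the middle range `2 ≤ p ≤ n - 2`**,
unconditionally (glue `abelianSchemeVHC_upTo_three` with the middle range from `4` on).
[cite: VoisinHodgeII2003, §10.2.3 proof of Prop. 10.26] [cite: VoisinHodgeI2002, Thm. 6.25 and Thm. 11.30] -/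
theorem abelianSchemeVHC_of_middleFrom_four (h : AbelianSchemeVHCMiddleFrom[4]) : AbelianSchemeVHC :=
  abelianSchemeVHC_of_upTo_of_middleFrom abelianSchemeVHC_upTo_three h

/-- **EXACTNESS OF THE FLOOR: row b02 `AbelianSchemeVHC` IS its restriction to families of abelian varieties of
relative dimension `n ≥ 4` and codimensions `2 ≤ p ≤ n - 2`**, unconditionally and fact-free. The first cell of the
binder with content is `(n, p) = (4, 2)`: codimension-2 classes along families of abelian FOURFOLDS (Charles–Schnell,
remark before Prop. 11.3.5: "very little seems to be known"). [cite: CharlesSchnell2014Notes, Conj. 11.3.1 and the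
remark before Prop. 11.3.5] [cite: VoisinHodgeI2002, Thm. 6.25 and Thm. 11.30] -/
theorem abelianSchemeVHC_iff_middleFrom_four : AbelianSchemeVHC ↔ AbelianSchemeVHCMiddleFrom[4] :=
  ⟨abelianSchemeVHCMiddleFrom_of_abelianSchemeVHC 4, abelianSchemeVHC_of_middleFrom_four⟩

/-! ## §3 Up the dimension axis: the class targets `HCUpToDim g` move the first open cell of row b02 -/

/-- **`HCUpToDim g ⟹ (row b02 ⟺ its restriction to relative dimension `n ≥ g + 1`, codimensions `2 ≤ p ≤ n - 2`)**:
the Hodge conjecture for complex abelian varieties of dimension `≤ g` (the cell's typed class target, no `HC_CM`)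
closes every dimension slice `n ≤ g` of row b02 (§1) and the Lefschetz range closes the rest off the middle (§2).
[cite: CharlesSchnell2014Notes, Cor. 11.3.6] [cite: VoisinHodgeI2002, Thm. 6.25 and Thm. 11.30] -/
theorem abelianSchemeVHC_iff_middleFrom_of_hcUpToDim {g : ℕ} (h : HCUpToDim g) :
    AbelianSchemeVHC ↔ AbelianSchemeVHCMiddleFrom[g + 1] :=
  ⟨abelianSchemeVHCMiddleFrom_of_abelianSchemeVHC (g + 1),
    abelianSchemeVHC_of_upTo_of_middleFrom (abelianSchemeVHC_upTo_of_hcUpToDim h)⟩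

/-- **Row b02 up to relative dimension `5`, granted the support item `HodgeAbelianDimLeFive`** of route
`SevenfoldWeilCensus` (stmt-HodgeConjecture-18723, BY NAME: the Hodge conjecture for complex abelian varieties of
dimension `≤ 5`; in print Markman 2025, arXiv:2509.23403 Cor. 1.3, UNREFEREED — a CLAIM; OPEN in the tree), through
`Ring2.ClassTargets.hcUpToDim_five_iff_hodgeAbelianDimLeFive`. [cite: MoonenZarhin1999LowDim, Thms. 0.1–0.2]
[cite: Markman2025SurveySecant, Cor. 1.3 (unrefereed)] -/
theorem abelianSchemeVHC_upTo_five_of_hodgeAbelianDimLeFive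
    (h₅ : Theses.SevenfoldWeilCensus.HodgeAbelianDimLeFive) : AbelianSchemeVHCUpTo[5] :=
  abelianSchemeVHC_upTo_of_hcUpToDim (hcUpToDim_five_iff_hodgeAbelianDimLeFive.mpr h₅)

/-- **Row b02 up to relative dimension `5` from the two PRINTED inputs of the atlas rows `g = 4, 5`, no `HC_CM`**:
the Weil classes on Weil-type abelian fourfolds (`Markman2025_weilClasses_algebraic_abelianFourfold`, arXiv:2502.03415
Cor. 1.6.1 — UNREFEREED in general, a CLAIM; refereed for discriminant `1` and for the general member over `ℚ(√-3)`,
`ℚ(i)`: Schoen 1988, van Geemen 1994) and Moonen–Zarhin's refereed reduction of all Hodge classes on abelian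
varieties of dimension `≤ 5` to divisors and those Weil classes
(`MoonenZarhin1999_hodgeClasses_abelian_dim_le_five_of_weilClassesFourfolds`), both displayed as hypotheses.
[cite: MoonenZarhin1999LowDim, Thms. 0.1–0.2] [cite: Markman2025SecantWeil, Cor. 1.6.1 (unrefereed)]
[cite: Schoen1988HodgeWeil, Thm.] [cite: vanGeemen1994HodgeAV, §7.1–7.2 and §7.4] -/
theorem abelianSchemeVHC_upTo_five_of_weilClassesFourfolds_of_moonenZarhin
    (hW : Markman2025_weilClasses_algebraic_abelianFourfold)
    (hMZ : MoonenZarhin1999_hodgeClasses_abelian_dim_le_five_of_weilClassesFourfolds) : AbelianSchemeVHCUpTo[5] :=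
  abelianSchemeVHC_upTo_of_hcUpToDim (hcUpToDim_five_of_weilClassesFourfolds_of_moonenZarhin hW hMZ)

/-- **Modulo Markman's fourfold claim and Moonen–Zarhin, row b02 IS its restriction to families of abelian varieties
of relative dimension `n ≥ 6` and codimensions `2 ≤ p ≤ n - 2`**: the first cell of the binder not covered by a
refereed theorem or by Markman's Weil-fourfold claim is `(n, p) = (6, 2)` (and `(6, 3)`, `(6, 4)`).
[cite: MoonenZarhin1999LowDim, Thms. 0.1–0.2 and §5] [cite: Markman2025SecantWeil, Cor. 1.6.1 (unrefereed)] -/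
theorem abelianSchemeVHC_iff_middleFrom_six_of_weilClassesFourfolds_of_moonenZarhin
    (hW : Markman2025_weilClasses_algebraic_abelianFourfold)
    (hMZ : MoonenZarhin1999_hodgeClasses_abelian_dim_le_five_of_weilClassesFourfolds) :
    AbelianSchemeVHC ↔ AbelianSchemeVHCMiddleFrom[6] :=
  abelianSchemeVHC_iff_middleFrom_of_hcUpToDim (hcUpToDim_five_of_weilClassesFourfolds_of_moonenZarhin hW hMZ)

/-- The same granted the support item `HodgeAbelianDimLeFive` (stmt-18723) by name. [cite: Markman2025SurveySecant, Cor. 1.3 (unrefereed)] -/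
theorem abelianSchemeVHC_iff_middleFrom_six_of_hodgeAbelianDimLeFive
    (h₅ : Theses.SevenfoldWeilCensus.HodgeAbelianDimLeFive) : AbelianSchemeVHC ↔ AbelianSchemeVHCMiddleFrom[6] :=
  abelianSchemeVHC_iff_middleFrom_of_hcUpToDim (hcUpToDim_five_iff_hodgeAbelianDimLeFive.mpr h₅)

/-- **Row b02 up to relative dimension `7`, granted the four OPEN items of route `SevenfoldWeilCensus` by name**
(`CodimTwoFromLowerDim` stmt-18721, `CodimThreeWeilGeneration` stmt-18720, `WeilSixfolds` stmt-2524,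
`HodgeAbelianDimLeFive` stmt-18723; no `HC_CM`), through that route's PROVED assembly packaged as
`Ring2.ClassTargets.hcUpToDim_seven_of_sevenfoldWeilCensus`. [cite: MoonenZarhin1999LowDim, §2 (2.7)–(2.8) and §5] -/
theorem abelianSchemeVHC_upTo_seven_of_sevenfoldWeilCensus (h₃ : Theses.SevenfoldWeilCensus.CodimTwoFromLowerDim)
    (h₂ : Theses.SevenfoldWeilCensus.CodimThreeWeilGeneration) (h₄ : Theses.SevenfoldWeilCensus.WeilSixfolds)
    (h₅ : Theses.SevenfoldWeilCensus.HodgeAbelianDimLeFive) : AbelianSchemeVHCUpTo[7] :=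
  abelianSchemeVHC_upTo_of_hcUpToDim (hcUpToDim_seven_of_sevenfoldWeilCensus h₃ h₂ h₄ h₅)

/-- … after which row b02 IS its restriction to relative dimension `n ≥ 8`, codimensions `2 ≤ p ≤ n - 2` (the
abelian-scheme shadow of the residual `Theses.SevenfoldWeilCensus.HodgeAbelianDimGeEight`).
[cite: MoonenZarhin1999LowDim, §2 (2.7)–(2.8) and §5] -/
theorem abelianSchemeVHC_iff_middleFrom_eight_of_sevenfoldWeilCensus
    (h₃ : Theses.SevenfoldWeilCensus.CodimTwoFromLowerDim) (h₂ : Theses.SevenfoldWeilCensus.CodimThreeWeilGeneration)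
    (h₄ : Theses.SevenfoldWeilCensus.WeilSixfolds) (h₅ : Theses.SevenfoldWeilCensus.HodgeAbelianDimLeFive) :
    AbelianSchemeVHC ↔ AbelianSchemeVHCMiddleFrom[8] :=
  abelianSchemeVHC_iff_middleFrom_of_hcUpToDim (hcUpToDim_seven_of_sevenfoldWeilCensus h₃ h₂ h₄ h₅)

/-! ## §4 The deep middle of `HC_AV` suffices for row b02 -/

/-- **Row b02 follows from the Hodge conjecture for rational `(p,p)`-classes with `2 ≤ p`, `2p ≤ dim A` on complex
abelian varieties** — `HC_AV` is equivalent to that deep-middle statement unconditionally (the tree's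
`HodgeAbelianVarieties.Negative.hodgeAbelianVarieties_iff_deepMiddle`, fed with the discharged Hodge models,
Lefschetz `(1,1)` and hard Lefschetz; Kerr–Pearlstein's halving by induction on the codimension), and `HC_AV` gives
row b02 (`abelianSchemeVHC_of_hc_av`). HONEST LIMIT: this is FIBREWISE halving; the binder is not shown equivalent
to its own lower half `2 ≤ p ≤ n/2` (see the module docstring). [cite: KerrPearlstein2011, §3.1]
[cite: VoisinHodgeI2002, Thm. 6.25, Rem. 6.27 and Thm. 11.30] -/
theorem abelianSchemeVHC_of_hodgeAbelianVarieties_deepMiddle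
    (h : ∀ (A : AbelianVariety ℂ) (p : ℕ), 2 ≤ p → 2 * p ≤ A.dim →
      ∀ c : complexBetti A.X (2 * p), IsRationalClass c → IsOfHodgeType A.dim A.X (2 * p) p p c →
        c ∈ algebraicClasses A.X p) :
    AbelianSchemeVHC :=
  abelianSchemeVHC_of_hc_av
    ((Theorems.HodgeAbelianVarieties.Negative.hodgeAbelianVarieties_iff_deepMiddle
        (fun _ _ ↦ nonempty_hodgeModel_holds) lefschetzOneOne_rational_holds nonempty_hardLefschetzNFold_holds).2 h)

/-- **Above the middle, row b02 is dominated FIBREWISE by the Hodge conjecture below the middle**: for `n < 2p`,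
the conclusion of row b02 at `s` in codimension `p` follows from the algebraicity of the rational
`(n-p, n-p)`-classes of the ONE abelian variety `A' ≅ 𝒳_s` (hard Lefschetz `L^{2p-n}` on the smooth projective
`n`-fold `𝒳_s`, tree theorem `HardLefschetzNFold.mem_algebraicClasses_of_lt_holds`, after transport along the
presentation). No anchor is used — which is exactly why this does NOT halve the binder as a variational statement.
[cite: KerrPearlstein2011, §3.1] [cite: VoisinHodgeI2002, Thm. 6.25 and Rem. 6.27] -/
theorem abelianSchemeVHC_conclusion_of_lt_of_belowMiddle {n : ℕ} {𝒳 S : SchemeOver ℂ} (f : 𝒳 ⟶ S)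
    (hf : IsSmoothProjectiveFamily f n) {p : ℕ} (hnp : n < 2 * p) (W : complexBetti 𝒳 (2 * p))
    (s : ComplexPoints S) {A' : AbelianVariety ℂ} (e : A'.X ≅ fiberOver f s)
    (hA' : ∀ c' : complexBetti A'.X (2 * (n - p)), IsRationalClass c' →
      IsOfHodgeType n A'.X (2 * (n - p)) (n - p) (n - p) c' → c' ∈ algebraicClasses A'.X (n - p))
    (hW : IsRationalClass (complexBetti.map (fiberι f s) (2 * p) W) ∧
      IsOfHodgeType n (fiberOver f s) (2 * p) p p (complexBetti.map (fiberι f s) (2 * p) W)) :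
    complexBetti.map (fiberι f s) (2 * p) W ∈ algebraicClasses (fiberOver f s) p :=
  HardLefschetzNFold.mem_algebraicClasses_of_lt_holds (hf.isSmoothProjective s) hnp
    ((forall_hodgeClass_mem_algebraicClasses_iff_of_iso e (n - p)).1 hA') _ hW.1 hW.2

/-! ## Audit: what the kernel now says about row b02, fact-free

`AbelianSchemeVHC ↔ AbelianSchemeVHCMiddleFrom[4]` (§2) with no hypothesis; `HCUpToDim g → (AbelianSchemeVHC ↔
AbelianSchemeVHCMiddleFrom[g+1])` (§3); the closures below are the three standard axioms only. `HC_CM` does not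
occur; no Literature named fact is used except as a displayed hypothesis (`hW`, `hMZ` of §3); route items enter by
name as hypotheses only. -/

#print axioms Summit.HodgeConjecture.HodgeConjecture.Ring2.Binders.abelianSchemeVHC_upTo_three
#print axioms Summit.HodgeConjecture.HodgeConjecture.Ring2.Binders.abelianSchemeVHC_iff_middleFrom_four
#print axioms Summit.HodgeConjecture.HodgeConjecture.Ring2.Binders.abelianSchemeVHC_iff_middleFrom_of_hcUpToDim
#print axioms Summit.HodgeConjecture.HodgeConjecture.Ring2.Binders.abelianSchemeVHC_of_hodgeAbelianVarieties_deepMiddle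

end Summit.HodgeConjecture.HodgeConjecture.Ring2.Binders

end
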